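import Summits.AtomisticToContinuum.Crystallization.Theorems.ChartedPlanarOrderPlanesTail
import Summits.AtomisticToContinuum.Crystallization.Theorems.ChartedPlanarOrderPlanesColumn

/-!
# Slot 7b by the method of planes, module P3e: rearranging the truncated virial BY PLANES (decomp-a2c lens-3 g26; critic row 523 (b))

Blocker `N = ChartedPlanarOrder.ChartedZeroExcessLayered`, leaf 7b `GapStressVanishesW (17/16)`.  For a stacked layered configuration
`Y = Layered a b w` with unit normal `ν ⊥ a, b` and heights in `[h_lo, h_hi]`, the column sum of module P3d at an atom `x = layerPoint (k, μ)`
of layer `k`, tested against `(ν, v)`, depends on the LAYER ONLY and is a finite combination of the truncated pair sums of module P3c: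

  `colSum Y ν v R (layerPoint (k, μ)) = col k := Σ_{|l − k| ≤ s₀} (z_k − z_l) ⟪v, Φ_R(k,l)⟫`,  `z_j = ⟪ν, w j⟫`

(`colSum_layerPoint`; translation along the layer lattice `…PlanesTail.layerPoint_sub_layerPoint` and `⟪ν, y − x⟫ = z_l − z_k` for `y` in
layer `l`; any `s₀` with `h_lo (s₀ + 1) > R` will do).  Consequently the truncated virial of a chunk `F` is a LAYERWISE sum weighted by the
layer counts `N_k` of `…PlanesCount`:

  `Σ_{x ∈ F} colSum Y ν v R x = Σ_{k} N_k · col k`    (`sum_colSum_eq_sum_layerCount_mul_col`).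

Mathlib only (+ the lens-3 modules imported); `[folklore]`; no instances, no notation, sorry-free.
-/

noncomputable section

open MeasureTheory Set Metric Filter Topology
open scoped RealInnerProductSpace
open Summit.AtomisticToContinuum.Crystallization.Theorems.ChartedPlanarOrderRigidityDoor
open Summit.AtomisticToContinuum.Crystallization.Theorems.ChartedPlanarOrderDensityDichotomy
open Summit.AtomisticToContinuum.Crystallization.Theorems.ChartedPlanarOrderMesoCut
open Summit.AtomisticToContinuum.Crystallization.Theorems.ChartedPlanarOrderProfileSlavingLJ (pairForce IsStacked)
open Summit.AtomisticToContinuum.Crystallization.Theorems.ChartedPlanarOrderProfileSlavingLJBalance (pairForce_neg)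
open Summit.AtomisticToContinuum.Crystallization.Theorems.ChartedPlanarOrderDoorLayered (Layered)
open Summit.AtomisticToContinuum.Crystallization.Theorems.ChartedPlanarOrderNashForceBalance
open Summit.AtomisticToContinuum.Crystallization.Theorems.ChartedPlanarOrderStraddleSummable (inner_layerPoint)
open Summit.AtomisticToContinuum.Crystallization.Theorems.ChartedPlanarOrderPlanesPairs (heights_of_le isStacked_of_heights)
open Summit.AtomisticToContinuum.Crystallization.Theorems.ChartedPlanarOrderPlanesTail
open Summit.AtomisticToContinuum.Crystallization.Theorems.ChartedPlanarOrderPlanesCount (idx mem_idx layerCount sum_eq_sum_idx sum_layerwise)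
open Summit.AtomisticToContinuum.Crystallization.Theorems.ChartedPlanarOrderPlanesColumn

namespace Summit.AtomisticToContinuum.Crystallization.Theorems.ChartedPlanarOrderPlanesRearrangement

variable {δ : ℝ} {a b ν : E3} {w : ℤ → E3} {h_lo h_hi : ℝ}

/-- ★ the COLUMN LOAD of layer `k` tested against `(ν, v)`: `col k = Σ_{|l − k| ≤ s₀} (z_k − z_l) ⟪v, Φ_R(k,l)⟫`. -/
def col (a b : E3) (w : ℤ → E3) (ν v : E3) (R : ℝ) (s₀ : ℕ) (k : ℤ) : ℝ :=
  ∑ l ∈ Finset.Icc (k - s₀) (k + s₀), (⟪ν, w k⟫ - ⟪ν, w l⟫) * ⟪v, PhiR a b w R k l⟫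

/-- the kernel between an atom of layer `k` and an atom of layer `s.1`, in translated form. -/
theorem vKer_layerPoint (hνa : ⟪ν, a⟫ = 0) (hνb : ⟪ν, b⟫ = 0) (v : E3) (k : ℤ) (μ : ℤ × ℤ) (s : ℤ × ℤ × ℤ) :
    vKer ν v (layerPoint a b w (k, μ)) (layerPoint a b w s) =
      (⟪ν, w k⟫ - ⟪ν, w s.1⟫) * ⟪v, pairForce (w k - layerPoint a b w (s.1, s.2 - μ))⟫ := by
  rw [vKer_eq_inner_pairForce, inner_sub_right, inner_layerPoint hνa hνb, inner_layerPoint hνa hνb]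
  have e : layerPoint a b w s - layerPoint a b w (k, μ) = -(w k - layerPoint a b w (s.1, s.2 - μ)) := by
    rw [← layerPoint_sub_layerPoint a b w k s.1 μ s.2, neg_sub]
  rw [e, pairForce_neg, inner_neg_right]
  dsimp only
  ring

/-- ★ THE COLUMN SUM AT AN ATOM OF LAYER `k` IS THE COLUMN LOAD OF THE LAYER. -/
theorem colSum_layerPoint (hδ : 0 < δ) (hS : IsSep δ (Layered a b w)) (hab : LinearIndependent ℝ ![a, b])
    (hν : ‖ν‖ = 1) (hνa : ⟪ν, a⟫ = 0) (hνb : ⟪ν, b⟫ = 0) (hlo : 0 < h_lo)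
    (hH : ∀ j : ℤ, h_lo ≤ ⟪ν, w (j + 1) - w j⟫ ∧ ⟪ν, w (j + 1) - w j⟫ ≤ h_hi)
    {R : ℝ} {s₀ : ℕ} (hs₀ : R < h_lo * ((s₀ : ℝ) + 1)) (v : E3) (k : ℤ) (μ : ℤ × ℤ) :
    colSum (Layered a b w) ν v R (layerPoint a b w (k, μ)) = col a b w ν v R s₀ k := by
  classical
  have hst : IsStacked a b w := isStacked_of_heights hνa hνb hlo hH
  have hinj : Function.Injective (layerPoint a b w) := layerPoint_injective hab hst
  have hsub : (↑(nbhd (Layered a b w) (layerPoint a b w (k, μ)) R) : Set E3) ⊆ Layered a b w := by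
    rw [coe_nbhd hδ hS]
    exact Set.inter_subset_left
  rw [colSum, sum_eq_sum_idx hinj _ hsub]
  set J := idx a b w hinj (nbhd (Layered a b w) (layerPoint a b w (k, μ)) R) with hJ
  have hmemJ : ∀ s : ℤ × ℤ × ℤ, s ∈ J ↔ ‖w k - layerPoint a b w (s.1, s.2 - μ)‖ ≤ R := by
    intro s
    rw [hJ, mem_idx, mem_nbhd hδ hS, and_iff_right (layerPoint_mem s), dist_eq_norm, norm_sub_rev,
      ← layerPoint_sub_layerPoint a b w k s.1 μ s.2]
  -- every layer met within range `R` is within `s₀` of `k`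
  have hmaps : ∀ s ∈ J, s.1 ∈ Finset.Icc (k - s₀) (k + s₀) := by
    intro s hs
    have h1 := (hmemJ s).mp hs
    have h2 := norm_sub_layerPoint_ge (a := a) (b := b) (w := w) hν hνa hνb hH k s.1 (s.2 - μ)
    have h3 : h_lo * |((s.1 - k : ℤ) : ℝ)| < h_lo * ((s₀ : ℝ) + 1) := lt_of_le_of_lt (h2.trans h1) hs₀
    have h4 : |((s.1 - k : ℤ) : ℝ)| < (s₀ : ℝ) + 1 := lt_of_mul_lt_mul_left h3 hlo.le
    have h5 : ((|s.1 - k| : ℤ) : ℝ) < (s₀ : ℝ) + 1 := by rw [Int.cast_abs]; exact h4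
    have h6 : |s.1 - k| < (s₀ : ℤ) + 1 := by exact_mod_cast h5
    have h7 := abs_lt.mp h6
    rw [Finset.mem_Icc]
    constructor <;> omega
  rw [← Finset.sum_fiberwise_of_maps_to hmaps]
  refine Finset.sum_congr rfl fun l _ => ?_
  calc ∑ s ∈ J.filter (fun s => s.1 = l), vKer ν v (layerPoint a b w (k, μ)) (layerPoint a b w s)
      = ∑ s ∈ J.filter (fun s => s.1 = l), (⟪ν, w k⟫ - ⟪ν, w l⟫) * ⟪v, pairForce (w k - layerPoint a b w (l, s.2 - μ))⟫ := by
        refine Finset.sum_congr rfl fun s hs => ?_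
        rw [vKer_layerPoint hνa hνb, (Finset.mem_filter.mp hs).2]
    _ = (⟪ν, w k⟫ - ⟪ν, w l⟫) * ⟪v, ∑ s ∈ J.filter (fun s => s.1 = l), pairForce (w k - layerPoint a b w (l, s.2 - μ))⟫ := by
        rw [inner_sum, Finset.mul_sum]
    _ = (⟪ν, w k⟫ - ⟪ν, w l⟫) * ⟪v, PhiR a b w R k l⟫ := by
        congr 2
        unfold PhiR
        refine Finset.sum_nbij' (fun s => s.2 - μ) (fun μ'' => (l, μ'' + μ)) ?_ ?_ ?_ ?_ ?_
        · intro s hs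
          rw [Finset.mem_filter] at hs
          rw [mem_near (nearSet_finite hδ hS hab hst R k l)]
          have h1 := (hmemJ s).mp hs.1
          rw [hs.2] at h1
          exact h1
        · intro μ'' hμ
          rw [mem_near (nearSet_finite hδ hS hab hst R k l)] at hμ
          rw [Finset.mem_filter, hmemJ]
          exact ⟨by rwa [add_sub_cancel_right], rfl⟩
        · intro s hs
          rw [Finset.mem_filter] at hs
          exact Prod.ext hs.2.symm (sub_add_cancel _ _)
        · intro μ'' _
          exact add_sub_cancel_right _ _
        · intro s _
          rfl

/-- ★★ THE TRUNCATED VIRIAL OF A CHUNK, BY PLANES: `Σ_{x ∈ F} colSum Y ν v R x = Σ_k N_k · col k` over the layers met by the chunk. -/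
theorem sum_colSum_eq_sum_layerCount_mul_col (hδ : 0 < δ) (hS : IsSep δ (Layered a b w)) (hab : LinearIndependent ℝ ![a, b])
    (hν : ‖ν‖ = 1) (hνa : ⟪ν, a⟫ = 0) (hνb : ⟪ν, b⟫ = 0) (hlo : 0 < h_lo)
    (hH : ∀ j : ℤ, h_lo ≤ ⟪ν, w (j + 1) - w j⟫ ∧ ⟪ν, w (j + 1) - w j⟫ ≤ h_hi)
    {R : ℝ} {s₀ : ℕ} (hs₀ : R < h_lo * ((s₀ : ℝ) + 1)) (v : E3)
    (hinj : Function.Injective (layerPoint a b w)) {F : Finset E3} (hF : (↑F : Set E3) ⊆ Layered a b w) :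
    ∑ x ∈ F, colSum (Layered a b w) ν v R x =
      ∑ k ∈ (idx a b w hinj F).image (fun s => s.1), (layerCount hinj F k : ℝ) * col a b w ν v R s₀ k := by
  rw [sum_eq_sum_idx hinj F hF]
  have h1 : ∀ s ∈ idx a b w hinj F, colSum (Layered a b w) ν v R (layerPoint a b w s) = col a b w ν v R s₀ s.1 :=
    fun s _ => colSum_layerPoint hδ hS hab hν hνa hνb hlo hH hs₀ v s.1 s.2
  rw [Finset.sum_congr rfl h1, sum_layerwise hinj F (col a b w ν v R s₀)]
  simp only [nsmul_eq_mul]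

end Summit.AtomisticToContinuum.Crystallization.Theorems.ChartedPlanarOrderPlanesRearrangement
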